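/-
Copyright: derived here (Resolution Observatory cell `pub-rosobs`, carver gen 60). AI-written Lean; AI review is
weaker than expert review.  Companion file of the cell's POLYNOMIAL weighted-centre model `W(f)` (engine 1's
`W(f)` / (P)-system TOY MODEL; CARVER-NOTES-eng1-g40 **T73** "the lowest Taylor coefficient of a substitution is a
derivation", the workhorse of the cell's THEOREM F hand proof).
Instrument — NOT a resolution theorem and NOT a statement about the invariant of [AbramovichTemkinWlodarczyk2024].
-/
import Literature.AlgebraicGeometry.Resolution.WeightedCentreGradedIsotropy
import Mathlib.RingTheory.Derivation.Basic
import Mathlib.Algebra.Polynomial.Div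
import Mathlib.Algebra.CharP.Lemmas
import Mathlib.Algebra.Polynomial.Expand
import Mathlib.Algebra.MvPolynomial.Variables
import HarnessLib

/-!
# The lowest non-vanishing Taylor coefficient of a substitution `Φ ≡ id (mod σ)` is a derivation

Setting (as in `WeightedCentreIsotropyTwist` / `WeightedCentreGradedIsotropy`): `A₀` a commutative ring, `A₀[σ] = A₀[X]`,
`Φ : A₀[σ] →+* A₀[σ]` a ring endomorphism (a "substitution with a parameter").  Its TAYLOR COEFFICIENT MAPS on
constants are `taylorCoeff Φ s : A₀ →+ A₀`, `a ↦ [σ^s] Φ(C a)` (`D_s` below).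

* `taylorCoeff_mul` — the HASSE–SCHMIDT PRODUCT RULE `D_s(ab) = Σ_{i+j=s} D_i(a)·D_j(b)`; with `D_0 = id`
  (`IsIdModSigma Φ : Φ ≡ id (mod σ)` on constants; ideal form `isIdModSigma_iff_forall_sub_mem_span_X`) the sequence
  `(D_s)_s` is a higher derivation in the sense of Hasse–F. K. Schmidt [Matsumura1987, §27, p. 207];
* **T73** `taylorCoeff_mul_of_forall_lt_eq_zero` — if `D_0 = id` and `D_s = 0` for `0 < s < s₀` (`0 < s₀`), then
  `D_{s₀}(ab) = a·D_{s₀}(b) + b·D_{s₀}(a)`: all cross terms of the product rule carry a factor `D_i`, `0 < i < s₀`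
  (the case `s₀ = 1` is "`D_1 ∈ Der_k(A)`" of [Matsumura1987, §27, p. 207]: `taylorCoeff_one_mul`);
* `lowestDerivation` — T73 packaged as a Mathlib `Derivation R A₀ A₀` when `Φ` fixes the scalars of `R`
  (`FixesScalars R Φ : ∀ r, Φ (C (algebraMap R A₀ r)) = C (algebraMap R A₀ r)`); `exists_lowest_taylorCoeff` — a
  substitution that moves some constant HAS a lowest index `s₀`;
* `taylorCoeff_eq_zero_of_isIsotropyOf` — a FIXED constant `g` (`IsIsotropyOf g Φ : Φ (C g) = C g`) has `D_s g = 0`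
  for all `s > 0`, in particular `lowestDerivation … g = 0` (`lowestDerivation_eq_zero_of_isIsotropyOf`); conversely
  `isIsotropyOf_iff_forall_taylorCoeff_eq_zero`;
* graded refinement — for a GRADED `Φ` (`IsGradedHom w ρ Φ`) and `a` weighted-homogeneous of weight `m`, `D_s a` is
  weighted-homogeneous of weight `m − s•ρ` (`IsGradedHom.isWeightedHomogeneous_taylorCoeff`): "`D_{s₀}` lowers
  weights by `s₀ρ`".

* `taylorVanishing Φ s₁` — the constants whose Taylor coefficients of order `0 < s < s₁` vanish form a SUBRING
  (Hasse–Schmidt product rule again), containing the fixed constants and the scalars; **T73 on that subring**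
  (`taylorCoeff_mul_of_mem_taylorVanishing`): `D_{s₁}(ab) = a·D_{s₁}(b) + b·D_{s₁}(a)` for `a, b ∈ taylorVanishing Φ s₁`
  — the "`Ê`" of THEOREM-F STEP 1c / STEP 5 (`X − id` has `σ`-order `s₁` on `k[N₀]` only); for `A₀ = k[ε]`:
  a polynomial all of whose variables lie in the subring lies in it (`mem_taylorVanishing_of_vars`), and
  `Φ(C g₀) − C g₀ = O(σ^{s₁})` there (`coeff_sub_C_eq_zero_of_mem_taylorVanishing`);
* characteristic `p` (**THEOREM-F STEP 5 identity (‡)**): `(f₁ + σℓ + dσ^{p+1})^p = f₁^p + σ^pℓ^p + d^pσ^{p(p+1)}`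
  (`frobeniusShift_pow`), hence for `Φ(C f₁) = C f₁ + σ·C ℓ + C d·σ^{p+1}`, `Φ(C a) = C a`:
  `Φ(C(a f₁^p + g₀)) − C(a f₁^p + g₀) = (Φ(C g₀) − C g₀) + C a·(σ^p ℓ^p + d^p σ^{p(p+1)})` (`apply_C_face_sub_eq`), so
  `Φ` fixes `a f₁^p + g₀` iff `Φ(C g₀) − C g₀ = −C a·(σ^pℓ^p + d^pσ^{p(p+1)})` (`isIsotropyOf_face_iff`), and then every
  Taylor coefficient of `g₀` is read off (`taylorCoeff_eq_of_isIsotropyOf_face`: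
  `D_s g₀ = −a·(ℓ^p·[s = p] + d^p·[s = p(p+1)])`; `mul_pow_eq_zero_of_isIsotropyOf_face`: if moreover
  `g₀ ∈ taylorVanishing Φ s₁` with `p < s₁` then `a·ℓ^p = 0` — STEP 5's case `s₁ > p`).

* `σ ↦ σ^q` bookkeeping (**THEOREM-F §4b, second proof of F via LEMMA XL**, both leaves): if `Φ(C a) = expand q (ψ a)`
  for all constants (`Φ` = "`ψ` followed by `σ ↦ σ^q`", e.g. the translation `ε_f ↦ ε_f + σ^{p+1}d` versus
  `ε_f ↦ ε_f + t·d`), then `Φ` and `ψ` fix the same constants (`isIsotropyOf_iff_of_expand`; leaf (b): "the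
  `σ^{n(p+1)}`-coefficients of `X(g) − g` are the Hasse derivatives, so `g(ε_f + t d) = g` identically"); a constant whose
  image is a polynomial in `σ^q` has `D_s = 0` for `q ∤ s` (`taylorCoeff_eq_zero_of_mem_range_expand`), such constants
  form a subring containing every polynomial in slots with that property (`apply_C_mem_of_vars`), and leaf (a):
  if `Φ(C f₁) = C f₁ + σC ℓ + C dσ^{p+1}`, `Φ(C a) = C a`, `Φ` fixes `a f₁^p + g₀` and `Φ(C g₀)` is a polynomial in
  `σ^{p+1}` ("`g₀(f_i + σ^{p+1}d_i)_{i ≥ 2}`"), then `a·ℓ^p = 0` (`mul_pow_eq_zero_of_isIsotropyOf_face_of_mem_range_expand`;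
  in a domain with `a ≠ 0`: `ℓ = 0`, `eq_zero_of_isIsotropyOf_face_of_mem_range_expand`) — "the `σ^p`-coefficient
  `aℓ(W)^p ≠ 0` contradicts `X(g) = g`".

No characteristic hypothesis outside the last two sections.  [Matsumura1987] H. Matsumura, Commutative Ring Theory, CUP, §27 "Higher
derivations", p. 207: `D = (D_0 = id, D_1, …)` with `D_i(xy) = Σ_{r+s=i} D_r(x)D_s(y)` ⇔ an algebra map
`E_t : A → A[t]`, `E_t(x) ≡ x (mod t)`; `D_1 ∈ Der_k(A)`; `D_i = 0` on the scalars for `i > 0`.  The `s₀ > 1` form and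
the formalisation are ours (CARVER-NOTES-eng1-g40 T73).  [AbramovichTemkinWlodarczyk2024, Thm. 5.3.1 (2)–(3)]
context only.
-/

namespace Literature.AlgebraicGeometry.Resolution.WeightedBlowup

open Polynomial

section LowestTaylor

variable {A₀ : Type*} [CommRing A₀]

/-- The `σ^s`-TAYLOR COEFFICIENT MAP of `Φ` on constants: `a ↦ [σ^s] Φ(C a)` (the `D_s` of the higher derivation
attached to `Φ`; ours). [cite: Matsumura1987, §27 (higher derivations), p. 207] -/
noncomputable def taylorCoeff (Φ : A₀[X] →+* A₀[X]) (s : ℕ) : A₀ →+ A₀ where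
  toFun a := (Φ (C a)).coeff s
  map_zero' := by simp only [map_zero, coeff_zero]
  map_add' a b := by simp only [map_add, coeff_add]

/-- Unfolding (ours). [cite: Matsumura1987, §27 (higher derivations), p. 207] -/
@[simp] theorem taylorCoeff_apply (Φ : A₀[X] →+* A₀[X]) (s : ℕ) (a : A₀) :
    taylorCoeff Φ s a = (Φ (C a)).coeff s := rfl

/-- **Hasse–Schmidt product rule** `D_s(ab) = Σ_{i+j=s} D_i(a) D_j(b)` — `Φ` is multiplicative
(derived here). [cite: Matsumura1987, §27 (higher derivations), p. 207] -/
theorem taylorCoeff_mul (Φ : A₀[X] →+* A₀[X]) (s : ℕ) (a b : A₀) :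
    taylorCoeff Φ s (a * b) = ∑ x ∈ Finset.antidiagonal s, taylorCoeff Φ x.1 a * taylorCoeff Φ x.2 b := by
  simp only [taylorCoeff_apply, map_mul, coeff_mul]

/-- `Φ ≡ id (mod σ)` on constants: `[σ^0] Φ(C a) = a`, i.e. `D_0 = id` (ours).
[cite: Matsumura1987, §27 (higher derivations), p. 207] -/
def IsIdModSigma (Φ : A₀[X] →+* A₀[X]) : Prop := ∀ a : A₀, (Φ (C a)).coeff 0 = a

/-- Unfolding (ours). [cite: Matsumura1987, §27 (higher derivations), p. 207] -/
theorem IsIdModSigma.taylorCoeff_zero {Φ : A₀[X] →+* A₀[X]} (h : IsIdModSigma Φ) (a : A₀) :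
    taylorCoeff Φ 0 a = a := h a

/-- Ideal form: `Φ(C a) − C a ∈ (σ)` for all `a` iff `D_0 = id` (derived here; `X ∣ f ↔ f.coeff 0 = 0`).
[cite: Matsumura1987, §27 (higher derivations), p. 207] -/
theorem isIdModSigma_iff_forall_sub_mem_span_X (Φ : A₀[X] →+* A₀[X]) :
    IsIdModSigma Φ ↔ ∀ a : A₀, Φ (C a) - C a ∈ Ideal.span {(X : A₀[X])} := by
  refine forall_congr' fun a => ?_
  rw [Ideal.mem_span_singleton, X_dvd_iff, coeff_sub, coeff_C_zero, sub_eq_zero]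

/-- A FIXED constant has no higher Taylor coefficients: `Φ(C g) = C g ⇒ D_s g = 0` for `s > 0` (derived here;
"`D` is trivial on `g`"). [cite: Matsumura1987, §27 (higher derivations), p. 207] -/
theorem taylorCoeff_eq_zero_of_isIsotropyOf {Φ : A₀[X] →+* A₀[X]} {g : A₀} (hg : IsIsotropyOf g Φ) {s : ℕ}
    (hs : 0 < s) : taylorCoeff Φ s g = 0 := by
  rw [taylorCoeff_apply, hg, coeff_C, if_neg hs.ne']

/-- Conversely, with `D_0 = id`: `g` is fixed iff all `D_s g`, `s > 0`, vanish (derived here).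
[cite: Matsumura1987, §27 (higher derivations), p. 207] -/
theorem isIsotropyOf_iff_forall_taylorCoeff_eq_zero {Φ : A₀[X] →+* A₀[X]} (h0 : IsIdModSigma Φ) (g : A₀) :
    IsIsotropyOf g Φ ↔ ∀ s, 0 < s → taylorCoeff Φ s g = 0 := by
  refine ⟨fun hg s hs => taylorCoeff_eq_zero_of_isIsotropyOf hg hs, fun h => ?_⟩
  refine Polynomial.ext fun n => ?_
  rcases Nat.eq_zero_or_pos n with rfl | hn
  · rw [h0 g, coeff_C_zero]
  · rw [coeff_C, if_neg hn.ne']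
    exact h n hn

/-- **T73 (lowest Taylor coefficient is a derivation).**  If `D_0 = id` and `D_s = 0` for `0 < s < s₀` (`s₀ > 0`),
then `D_{s₀}(ab) = a·D_{s₀}(b) + b·D_{s₀}(a)`: in the product rule every other term has a factor `D_i` with
`0 < i < s₀` (derived here; `s₀ = 1` is [Matsumura1987, §27]'s `D_1 ∈ Der`).
[cite: Matsumura1987, §27 (higher derivations), p. 207] -/
theorem taylorCoeff_mul_of_forall_lt_eq_zero {Φ : A₀[X] →+* A₀[X]} (h0 : IsIdModSigma Φ) {s₀ : ℕ}
    (hs₀ : 0 < s₀) (hvan : ∀ s, 0 < s → s < s₀ → taylorCoeff Φ s = 0) (a b : A₀) :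
    taylorCoeff Φ s₀ (a * b) = a * taylorCoeff Φ s₀ b + b * taylorCoeff Φ s₀ a := by
  rw [taylorCoeff_mul]
  have hne : ((0, s₀) : ℕ × ℕ) ≠ (s₀, 0) := by
    intro h
    have := (Prod.mk.inj h).1
    omega
  rw [Finset.sum_eq_add_of_mem ((0, s₀) : ℕ × ℕ) (s₀, 0) (by simp) (by simp) hne]
  · rw [h0.taylorCoeff_zero, h0.taylorCoeff_zero, mul_comm (taylorCoeff Φ s₀ a) b]
  · rintro ⟨i, j⟩ hij hij'
    have hs : i + j = s₀ := Finset.mem_antidiagonal.mp hij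
    have hi0 : i ≠ 0 := by
      rintro rfl
      rw [zero_add] at hs
      subst hs
      exact hij'.1 rfl
    have his : i ≠ s₀ := by
      rintro rfl
      have hj : j = 0 := by omega
      subst hj
      exact hij'.2 rfl
    rw [hvan i (Nat.pos_of_ne_zero hi0) (by omega), AddMonoidHom.zero_apply, zero_mul]

/-- The first Taylor coefficient is ALWAYS a derivation when `D_0 = id` (`s₀ = 1`; derived here).
[cite: Matsumura1987, §27 (higher derivations), p. 207] -/
theorem taylorCoeff_one_mul {Φ : A₀[X] →+* A₀[X]} (h0 : IsIdModSigma Φ) (a b : A₀) :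
    taylorCoeff Φ 1 (a * b) = a * taylorCoeff Φ 1 b + b * taylorCoeff Φ 1 a :=
  taylorCoeff_mul_of_forall_lt_eq_zero h0 one_pos (fun s hs hs' => by omega) a b

/-- A substitution that moves SOME constant in a positive `σ`-degree has a LOWEST such degree `s₀`, below which all
`D_s` (`0 < s < s₀`) vanish identically (derived here; `Nat.find`). [cite: Matsumura1987, §27 (higher derivations), p. 207] -/
theorem exists_lowest_taylorCoeff {Φ : A₀[X] →+* A₀[X]} (h : ∃ s, 0 < s ∧ taylorCoeff Φ s ≠ 0) :
    ∃ s₀, 0 < s₀ ∧ taylorCoeff Φ s₀ ≠ 0 ∧ ∀ s, 0 < s → s < s₀ → taylorCoeff Φ s = 0 := by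
  classical
  refine ⟨Nat.find h, (Nat.find_spec h).1, (Nat.find_spec h).2, fun s hs hlt => ?_⟩
  by_contra hne
  exact Nat.find_min h hlt ⟨hs, hne⟩

/-- With `D_0 = id`, a constant `g` that is NOT fixed is moved in some positive `σ`-degree (derived here).
[cite: Matsumura1987, §27 (higher derivations), p. 207] -/
theorem exists_taylorCoeff_ne_zero_of_not_isIsotropyOf {Φ : A₀[X] →+* A₀[X]} (h0 : IsIdModSigma Φ) {g : A₀}
    (hg : ¬ IsIsotropyOf g Φ) : ∃ s, 0 < s ∧ taylorCoeff Φ s ≠ 0 := by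
  by_contra h
  push Not at h
  exact hg ((isIsotropyOf_iff_forall_taylorCoeff_eq_zero h0 g).2 fun s hs => by rw [h s hs, AddMonoidHom.zero_apply])

section Scalars

variable (R : Type*) [CommRing R] [Algebra R A₀]

/-- `Φ` fixes the scalars of `R`: `Φ(C r) = C r` for `r ∈ R ⊆ A₀` (ours; the "`k`-linear" of a higher
`k`-derivation). [cite: Matsumura1987, §27 (higher derivations), p. 207] -/
def FixesScalars (Φ : A₀[X] →+* A₀[X]) : Prop := ∀ r : R, Φ (C (algebraMap R A₀ r)) = C (algebraMap R A₀ r)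

variable {R}

/-- `D_s` vanishes on the scalars for `s > 0` (derived here). [cite: Matsumura1987, §27 (higher derivations), p. 207] -/
theorem FixesScalars.taylorCoeff_algebraMap {Φ : A₀[X] →+* A₀[X]} (hR : FixesScalars R Φ) {s : ℕ} (hs : 0 < s)
    (r : R) : taylorCoeff Φ s (algebraMap R A₀ r) = 0 :=
  taylorCoeff_eq_zero_of_isIsotropyOf (hR r) hs

/-- **T73 packaged**: under `D_0 = id`, `D_s = 0` for `0 < s < s₀`, and `Φ` fixing the scalars of `R`, the lowest Taylor
coefficient `D_{s₀}` IS an `R`-derivation of `A₀` (derived here). [cite: Matsumura1987, §27 (higher derivations), p. 207] -/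
noncomputable def lowestDerivation (Φ : A₀[X] →+* A₀[X]) (h0 : IsIdModSigma Φ) (hR : FixesScalars R Φ) (s₀ : ℕ)
    (hs₀ : 0 < s₀) (hvan : ∀ s, 0 < s → s < s₀ → taylorCoeff Φ s = 0) : Derivation R A₀ A₀ where
  toFun := taylorCoeff Φ s₀
  map_add' a b := map_add _ a b
  map_smul' r a := by
    rw [RingHom.id_apply, Algebra.smul_def, taylorCoeff_mul_of_forall_lt_eq_zero h0 hs₀ hvan,
      hR.taylorCoeff_algebraMap hs₀, mul_zero, add_zero, Algebra.smul_def]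
  map_one_eq_zero' := by
    change taylorCoeff Φ s₀ 1 = 0
    rw [taylorCoeff_apply, map_one, map_one, coeff_one, if_neg hs₀.ne']
  leibniz' a b := by
    change taylorCoeff Φ s₀ (a * b) = a • taylorCoeff Φ s₀ b + b • taylorCoeff Φ s₀ a
    rw [smul_eq_mul, smul_eq_mul]
    exact taylorCoeff_mul_of_forall_lt_eq_zero h0 hs₀ hvan a b

/-- Unfolding (ours). [cite: Matsumura1987, §27 (higher derivations), p. 207] -/
@[simp] theorem lowestDerivation_apply (Φ : A₀[X] →+* A₀[X]) (h0 : IsIdModSigma Φ) (hR : FixesScalars R Φ)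
    (s₀ : ℕ) (hs₀ : 0 < s₀) (hvan : ∀ s, 0 < s → s < s₀ → taylorCoeff Φ s = 0) (a : A₀) :
    lowestDerivation Φ h0 hR s₀ hs₀ hvan a = (Φ (C a)).coeff s₀ := rfl

/-- The lowest derivation KILLS every fixed constant: `Φ(C g) = C g ⇒ D_{s₀} g = 0` (derived here; in the cell: a
graded isotropy of `G` yields a derivation annihilating `G`, the input of THEOREM LT).
[cite: Matsumura1987, §27 (higher derivations), p. 207] -/
theorem lowestDerivation_eq_zero_of_isIsotropyOf (Φ : A₀[X] →+* A₀[X]) (h0 : IsIdModSigma Φ)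
    (hR : FixesScalars R Φ) (s₀ : ℕ) (hs₀ : 0 < s₀) (hvan : ∀ s, 0 < s → s < s₀ → taylorCoeff Φ s = 0) {g : A₀}
    (hg : IsIsotropyOf g Φ) : lowestDerivation Φ h0 hR s₀ hs₀ hvan g = 0 :=
  taylorCoeff_eq_zero_of_isIsotropyOf hg hs₀

end Scalars

end LowestTaylor

section Graded

variable {k : Type*} [CommRing k] {ι : Type*} {M : Type*} [AddCommGroup M] {w : ι → M} {ρ : M}

/-- A graded `Φ` fixes the scalars `k` (ours; restatement of `IsGradedHom.map_C_C`).
[cite: AbramovichTemkinWlodarczyk2024, Thm. 5.3.1 (2)–(3) (p. 1578)] -/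
theorem IsGradedHom.fixesScalars {Φ : (MvPolynomial ι k)[X] →+* (MvPolynomial ι k)[X]} (hΦ : IsGradedHom w ρ Φ) :
    FixesScalars k Φ := fun c => by
  rw [MvPolynomial.algebraMap_eq]
  exact hΦ.map_C_C c

/-- **Graded refinement of T73**: for a graded `Φ` and `a` weighted-homogeneous of weight `m`, the Taylor coefficient
`D_s a` is weighted-homogeneous of weight `m − s•ρ` — "`D_{s₀}` lowers weights by `s₀ρ`" (derived here, from
`IsGradedHom.isTW_map_C`). [cite: AbramovichTemkinWlodarczyk2024, Thm. 5.3.1 (2)–(3) (p. 1578)] -/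
theorem IsGradedHom.isWeightedHomogeneous_taylorCoeff {Φ : (MvPolynomial ι k)[X] →+* (MvPolynomial ι k)[X]}
    (hΦ : IsGradedHom w ρ Φ) {a : MvPolynomial ι k} {m : M} (ha : MvPolynomial.IsWeightedHomogeneous w a m)
    (s : ℕ) : MvPolynomial.IsWeightedHomogeneous w (taylorCoeff Φ s a) (m - s • ρ) :=
  hΦ.isTW_map_C ha s

/-- The same for the packaged derivation (derived here). [cite: AbramovichTemkinWlodarczyk2024, Thm. 5.3.1 (2)–(3) (p. 1578)] -/
theorem IsGradedHom.isWeightedHomogeneous_lowestDerivation {Φ : (MvPolynomial ι k)[X] →+* (MvPolynomial ι k)[X]}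
    (hΦ : IsGradedHom w ρ Φ) (h0 : IsIdModSigma Φ) (s₀ : ℕ) (hs₀ : 0 < s₀)
    (hvan : ∀ s, 0 < s → s < s₀ → taylorCoeff Φ s = 0) {a : MvPolynomial ι k} {m : M}
    (ha : MvPolynomial.IsWeightedHomogeneous w a m) :
    MvPolynomial.IsWeightedHomogeneous w (lowestDerivation Φ h0 hΦ.fixesScalars s₀ hs₀ hvan a) (m - s₀ • ρ) :=
  hΦ.isTW_map_C ha s₀

/-- For a graded ISOTROPY of `G` (`IsGradedIso w ρ G Φ`) with `D_0 = id`, the lowest derivation annihilates `G`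
(derived here). [cite: AbramovichTemkinWlodarczyk2024, Thm. 5.3.1 (2)–(3) (p. 1578)] -/
theorem IsGradedIso.lowestDerivation_eq_zero {G : MvPolynomial ι k}
    {Φ : (MvPolynomial ι k)[X] →+* (MvPolynomial ι k)[X]} (hΦ : IsGradedIso w ρ G Φ) (h0 : IsIdModSigma Φ)
    (s₀ : ℕ) (hs₀ : 0 < s₀) (hvan : ∀ s, 0 < s → s < s₀ → taylorCoeff Φ s = 0) :
    lowestDerivation Φ h0 hΦ.graded.fixesScalars s₀ hs₀ hvan G = 0 :=
  lowestDerivation_eq_zero_of_isIsotropyOf Φ h0 _ s₀ hs₀ hvan hΦ.iso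

end Graded

section Vanishing

variable {A₀ : Type*} [CommRing A₀]

/-- The constants ALL of whose Taylor coefficients of order `0 < s < s₁` vanish form a SUBRING of `A₀` (derived here:
closure under products is the Hasse–Schmidt product rule — in `D_s(ab) = Σ_{i+j=s} D_i(a)D_j(b)`, `s < s₁`, every term
has `0 < i < s₁` or `0 < j = s < s₁`). [cite: Matsumura1987, §27 (higher derivations), p. 207] -/
def taylorVanishing (Φ : A₀[X] →+* A₀[X]) (s₁ : ℕ) : Subring A₀ where
  carrier := {a | ∀ s, 0 < s → s < s₁ → taylorCoeff Φ s a = 0}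
  mul_mem' {a b} ha hb := fun s hs hlt => by
    rw [taylorCoeff_mul]
    refine Finset.sum_eq_zero fun x hx => ?_
    have hsum : x.1 + x.2 = s := Finset.mem_antidiagonal.mp hx
    rcases Nat.eq_zero_or_pos x.1 with h1 | h1
    · have h2 : x.2 = s := by omega
      rw [h2, hb s hs hlt, mul_zero]
    · rw [ha x.1 h1 (by omega), zero_mul]
  one_mem' := fun s hs _ => by
    rw [taylorCoeff_apply, map_one, map_one, coeff_one, if_neg hs.ne']
  add_mem' {a b} ha hb := fun s hs hlt => by rw [map_add, ha s hs hlt, hb s hs hlt, add_zero]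
  zero_mem' := fun s _ _ => map_zero _
  neg_mem' {a} ha := fun s hs hlt => by rw [map_neg, ha s hs hlt, neg_zero]

/-- Unfolding (ours). [cite: Matsumura1987, §27 (higher derivations), p. 207] -/
theorem mem_taylorVanishing {Φ : A₀[X] →+* A₀[X]} {s₁ : ℕ} {a : A₀} :
    a ∈ taylorVanishing Φ s₁ ↔ ∀ s, 0 < s → s < s₁ → taylorCoeff Φ s a = 0 := Iff.rfl

/-- `taylorVanishing Φ 1 = ⊤` and the subrings decrease in `s₁` (ours). [cite: Matsumura1987, §27 (higher derivations), p. 207] -/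
theorem taylorVanishing_anti {Φ : A₀[X] →+* A₀[X]} {s₁ s₂ : ℕ} (h : s₁ ≤ s₂) :
    taylorVanishing Φ s₂ ≤ taylorVanishing Φ s₁ := fun _ ha s hs hlt => ha s hs (lt_of_lt_of_le hlt h)

/-- With `D_s = 0` identically for `0 < s < s₀` (the hypothesis of T73), the vanishing subring is everything (ours).
[cite: Matsumura1987, §27 (higher derivations), p. 207] -/
theorem taylorVanishing_eq_top {Φ : A₀[X] →+* A₀[X]} {s₀ : ℕ} (hvan : ∀ s, 0 < s → s < s₀ → taylorCoeff Φ s = 0) :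
    taylorVanishing Φ s₀ = ⊤ :=
  top_unique fun a _ s hs hlt => by rw [hvan s hs hlt, AddMonoidHom.zero_apply]

/-- Fixed constants lie in every vanishing subring (derived here). [cite: Matsumura1987, §27 (higher derivations), p. 207] -/
theorem mem_taylorVanishing_of_isIsotropyOf {Φ : A₀[X] →+* A₀[X]} {g : A₀} (hg : IsIsotropyOf g Φ) (s₁ : ℕ) :
    g ∈ taylorVanishing Φ s₁ := fun _ hs _ => taylorCoeff_eq_zero_of_isIsotropyOf hg hs

/-- Scalars lie in every vanishing subring (derived here). [cite: Matsumura1987, §27 (higher derivations), p. 207] -/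
theorem FixesScalars.algebraMap_mem_taylorVanishing {R : Type*} [CommRing R] [Algebra R A₀] {Φ : A₀[X] →+* A₀[X]}
    (hR : FixesScalars R Φ) (s₁ : ℕ) (r : R) : algebraMap R A₀ r ∈ taylorVanishing Φ s₁ :=
  mem_taylorVanishing_of_isIsotropyOf (hR r) s₁

/-- **T73 on the vanishing subring** (the "`Ê`" of THEOREM-F STEP 1c / STEP 5: `X − id` of `σ`-order `s₁` on a
subring only): if `D_0 = id` then `D_{s₁}(ab) = a·D_{s₁}(b) + b·D_{s₁}(a)` for all `a, b ∈ taylorVanishing Φ s₁`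
(derived here; T73 is the case `taylorVanishing Φ s₀ = ⊤`). [cite: Matsumura1987, §27 (higher derivations), p. 207] -/
theorem taylorCoeff_mul_of_mem_taylorVanishing {Φ : A₀[X] →+* A₀[X]} (h0 : IsIdModSigma Φ) {s₁ : ℕ}
    (hs₁ : 0 < s₁) {a b : A₀} (ha : a ∈ taylorVanishing Φ s₁) (hb : b ∈ taylorVanishing Φ s₁) :
    taylorCoeff Φ s₁ (a * b) = a * taylorCoeff Φ s₁ b + b * taylorCoeff Φ s₁ a := by
  rw [taylorCoeff_mul]
  have hne : ((0, s₁) : ℕ × ℕ) ≠ (s₁, 0) := by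
    intro h
    have := (Prod.mk.inj h).1
    omega
  rw [Finset.sum_eq_add_of_mem ((0, s₁) : ℕ × ℕ) (s₁, 0) (by simp) (by simp) hne]
  · rw [h0.taylorCoeff_zero, h0.taylorCoeff_zero, mul_comm (taylorCoeff Φ s₁ a) b]
  · rintro ⟨i, j⟩ hij hij'
    have hs : i + j = s₁ := Finset.mem_antidiagonal.mp hij
    have hi0 : i ≠ 0 := by
      rintro rfl
      rw [zero_add] at hs
      subst hs
      exact hij'.1 rfl
    have his : i ≠ s₁ := by
      rintro rfl
      have hj : j = 0 := by omega
      subst hj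
      exact hij'.2 rfl
    rw [ha i (Nat.pos_of_ne_zero hi0) (by omega), zero_mul]

/-- On the vanishing subring, `Φ(C a) − C a = O(σ^{s₁})`: all `σ^s`-coefficients with `s < s₁` vanish when `D_0 = id`
(derived here). [cite: Matsumura1987, §27 (higher derivations), p. 207] -/
theorem coeff_sub_C_eq_zero_of_mem_taylorVanishing {Φ : A₀[X] →+* A₀[X]} (h0 : IsIdModSigma Φ) {s₁ : ℕ} {a : A₀}
    (ha : a ∈ taylorVanishing Φ s₁) {s : ℕ} (hs : s < s₁) : (Φ (C a) - C a).coeff s = 0 := by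
  rw [coeff_sub, coeff_C]
  rcases Nat.eq_zero_or_pos s with rfl | hpos
  · rw [if_pos rfl, h0 a, sub_self]
  · rw [if_neg hpos.ne', sub_zero]
    exact ha s hpos hs

/-- The positive-order coefficients of `Φ(C a) − C a` ARE the Taylor coefficients (derived here).
[cite: Matsumura1987, §27 (higher derivations), p. 207] -/
theorem coeff_sub_C_eq_taylorCoeff (Φ : A₀[X] →+* A₀[X]) (a : A₀) {s : ℕ} (hs : 0 < s) :
    (Φ (C a) - C a).coeff s = taylorCoeff Φ s a := by
  rw [coeff_sub, coeff_C, if_neg hs.ne', sub_zero, taylorCoeff_apply]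

/-- For `A₀ = k[ε_ι]` and `Φ` fixing the scalars: a polynomial all of whose variables lie in a vanishing subring lies
in it — "`k[N₀] ⊆ taylorVanishing Φ s₁` as soon as every `ε_x`, `x ∈ N₀`, does" (derived here).
[cite: Matsumura1987, §27 (higher derivations), p. 207] -/
theorem mem_taylorVanishing_of_vars {k : Type*} [CommRing k] {ι : Type*}
    {Φ : (MvPolynomial ι k)[X] →+* (MvPolynomial ι k)[X]} (hR : FixesScalars k Φ) {s₁ : ℕ}
    {g : MvPolynomial ι k} (h : ∀ x ∈ g.vars, MvPolynomial.X x ∈ taylorVanishing Φ s₁) :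
    g ∈ taylorVanishing Φ s₁ := by
  classical
  rw [g.as_sum]
  refine Subring.sum_mem _ fun d hd => ?_
  rw [MvPolynomial.monomial_eq]
  refine Subring.mul_mem _ ?_ (Subring.prod_mem _ fun i hi => Subring.pow_mem _ (h i ?_) _)
  · have := hR.algebraMap_mem_taylorVanishing s₁ (MvPolynomial.coeff d g)
    rwa [MvPolynomial.algebraMap_eq] at this
  · exact (MvPolynomial.mem_vars_iff_mem_support i).mpr ⟨d, hd, hi⟩

end Vanishing

section FrobeniusFace

variable {A₀ : Type*} [CommRing A₀] (p : ℕ) [Fact p.Prime] [CharP A₀ p]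

/-- `(f + σℓ + dσ^{p+1})^p = f^p + σ^p ℓ^p + d^p σ^{p(p+1)}` in characteristic `p` (derived here; `add_pow_char` twice).
[cite: Lang2002, Ch. V §6 (pp. 247–251)] -/
theorem frobeniusShift_pow (f ℓ d : A₀) :
    (C f + X * C ℓ + C d * X ^ (p + 1)) ^ p = C f ^ p + X ^ p * C ℓ ^ p + C d ^ p * X ^ (p * (p + 1)) := by
  rw [add_pow_char _ _ p, add_pow_char _ _ p, mul_pow, mul_pow, ← pow_mul, mul_comm (p + 1) p]

/-- **THEOREM-F STEP 5 identity (‡), unconditional form**: for `Φ(C f₁) = C f₁ + σ·C ℓ + C d·σ^{p+1}` and a fixed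
coefficient `a` (`Φ(C a) = C a`),
`Φ(C(a f₁^p + g₀)) − C(a f₁^p + g₀) = (Φ(C g₀) − C g₀) + C a·(σ^p (C ℓ)^p + (C d)^p σ^{p(p+1)})` (derived here).
[cite: Lang2002, Ch. V §6 (pp. 247–251)] -/
theorem apply_C_face_sub_eq (Φ : A₀[X] →+* A₀[X]) {f₁ ℓ d a : A₀} (g₀ : A₀)
    (hf : Φ (C f₁) = C f₁ + X * C ℓ + C d * X ^ (p + 1)) (ha : Φ (C a) = C a) :
    Φ (C (a * f₁ ^ p + g₀)) - C (a * f₁ ^ p + g₀)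
      = (Φ (C g₀) - C g₀) + C a * (X ^ p * C ℓ ^ p + C d ^ p * X ^ (p * (p + 1))) := by
  simp only [map_add, map_mul, map_pow, ha, hf, frobeniusShift_pow p]
  ring

/-- **(‡)**: `Φ` fixes `a f₁^p + g₀` iff `Φ(C g₀) − C g₀ = −C a·(σ^p(C ℓ)^p + (C d)^pσ^{p(p+1)})` (derived here).
[cite: Lang2002, Ch. V §6 (pp. 247–251)] -/
theorem isIsotropyOf_face_iff (Φ : A₀[X] →+* A₀[X]) {f₁ ℓ d a : A₀} (g₀ : A₀)
    (hf : Φ (C f₁) = C f₁ + X * C ℓ + C d * X ^ (p + 1)) (ha : Φ (C a) = C a) :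
    IsIsotropyOf (a * f₁ ^ p + g₀) Φ ↔
      Φ (C g₀) - C g₀ = -(C a * (X ^ p * C ℓ ^ p + C d ^ p * X ^ (p * (p + 1)))) := by
  rw [IsIsotropyOf, ← sub_eq_zero, apply_C_face_sub_eq p Φ g₀ hf ha, add_eq_zero_iff_eq_neg]

/-- Reading off the Taylor coefficients of `g₀` from (‡): `D_s g₀ = −a·(ℓ^p·[s = p] + d^p·[s = p(p+1)])` for every
`s > 0` (derived here). [cite: Lang2002, Ch. V §6 (pp. 247–251)] -/
theorem taylorCoeff_eq_of_isIsotropyOf_face (Φ : A₀[X] →+* A₀[X]) {f₁ ℓ d a g₀ : A₀}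
    (hf : Φ (C f₁) = C f₁ + X * C ℓ + C d * X ^ (p + 1)) (ha : Φ (C a) = C a)
    (hfix : IsIsotropyOf (a * f₁ ^ p + g₀) Φ) {s : ℕ} (hs : 0 < s) :
    taylorCoeff Φ s g₀ = -(a * ((if s = p then ℓ ^ p else 0) + (if s = p * (p + 1) then d ^ p else 0))) := by
  have h := (isIsotropyOf_face_iff p Φ g₀ hf ha).mp hfix
  have hc := congrArg (fun q : A₀[X] => q.coeff s) h
  simp only [coeff_sub_C_eq_taylorCoeff Φ g₀ hs] at hc
  have hre : C a * (X ^ p * C ℓ ^ p + C d ^ p * X ^ (p * (p + 1)))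
      = C (a * ℓ ^ p) * X ^ p + C (a * d ^ p) * X ^ (p * (p + 1)) := by
    simp only [map_mul, map_pow]
    ring
  rw [hc, hre, coeff_neg, coeff_add, coeff_C_mul_X_pow, coeff_C_mul_X_pow]
  split_ifs <;> ring

/-- **STEP 5, case `s₁ > p`**: if moreover `g₀ ∈ taylorVanishing Φ s₁` with `p < s₁` (all of `D_1 g₀, …, D_p g₀`
vanish), then `a·ℓ^p = 0` — in a domain with `a ≠ 0`, `ℓ` nilpotent hence `0` (derived here).
[cite: Lang2002, Ch. V §6 (pp. 247–251)] -/
theorem mul_pow_eq_zero_of_isIsotropyOf_face (Φ : A₀[X] →+* A₀[X]) {f₁ ℓ d a g₀ : A₀}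
    (hf : Φ (C f₁) = C f₁ + X * C ℓ + C d * X ^ (p + 1)) (ha : Φ (C a) = C a)
    (hfix : IsIsotropyOf (a * f₁ ^ p + g₀) Φ) {s₁ : ℕ} (hg₀ : g₀ ∈ taylorVanishing Φ s₁) (hps : p < s₁) :
    a * ℓ ^ p = 0 := by
  have hp : 0 < p := (Fact.out : p.Prime).pos
  have hne : p ≠ p * (p + 1) := by
    have : p * 2 ≤ p * (p + 1) := Nat.mul_le_mul_left p (by have := (Fact.out : p.Prime).two_le; omega)
    omega
  have h := taylorCoeff_eq_of_isIsotropyOf_face p Φ hf ha hfix hp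
  rw [hg₀ p hp hps, if_pos rfl, if_neg hne, add_zero] at h
  have h' : a * ℓ ^ p = -0 := by rw [h, neg_neg]
  rwa [neg_zero] at h'

end FrobeniusFace

section ExpandRange

variable {A₀ : Type*} [CommRing A₀]

/-- **`σ ↦ σ^q` does not change the fixed constants** (derived here; THEOREM-F §4b leaf (b)): if
`Φ(C a) = expand q (ψ a)` for every constant `a` (`0 < q`), then `Φ` fixes `g` iff `ψ g = C g`.  With `ψ` the
translation `F ↦ F(ε + t·d)` this is "`g(ε_f + σ^{p+1}d) = g ⇔ g(ε_f + t d) = g` identically in `t`".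
[cite: Matsumura1987, §27 (higher derivations), p. 207] -/
theorem isIsotropyOf_iff_of_expand {Φ : A₀[X] →+* A₀[X]} {q : ℕ} (hq : 0 < q) (ψ : A₀ → A₀[X])
    (hΦ : ∀ a, Φ (C a) = expand A₀ q (ψ a)) (g : A₀) : IsIsotropyOf g Φ ↔ ψ g = C g := by
  rw [IsIsotropyOf, hΦ]
  constructor
  · intro h
    apply expand_injective hq
    rwa [expand_C]
  · intro h
    rw [h, expand_C]

/-- A constant whose image is a polynomial in `σ^q` has `D_s = 0` for every `s` not divisible by `q` (derived here).
[cite: Matsumura1987, §27 (higher derivations), p. 207] -/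
theorem taylorCoeff_eq_zero_of_mem_range_expand {Φ : A₀[X] →+* A₀[X]} {q : ℕ} (hq : 0 < q) {a : A₀}
    (ha : Φ (C a) ∈ (expand A₀ q).range) {s : ℕ} (hs : ¬ q ∣ s) : taylorCoeff Φ s a = 0 := by
  obtain ⟨f, hf⟩ := (AlgHom.mem_range _).mp ha
  rw [taylorCoeff_apply, ← hf, coeff_expand hq, if_neg hs]

/-- `C f + C d·σ^q` is a polynomial in `σ^q` (ours, bookkeeping: the slots `f_i ↦ f_i + σ^{p+1}d_i`).
[cite: Matsumura1987, §27 (higher derivations), p. 207] -/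
theorem C_add_C_mul_X_pow_mem_range_expand (q : ℕ) (f d : A₀) : C f + C d * X ^ q ∈ (expand A₀ q).range :=
  (AlgHom.mem_range _).mpr ⟨C f + C d * X, by rw [map_add, map_mul, expand_C, expand_C, expand_X]⟩

/-- Constants are polynomials in `σ^q` (ours, bookkeeping: the fixed slots and the scalars).
[cite: Matsumura1987, §27 (higher derivations), p. 207] -/
theorem C_mem_range_expand (q : ℕ) (f : A₀) : (C f : A₀[X]) ∈ (expand A₀ q).range :=
  (AlgHom.mem_range _).mpr ⟨C f, expand_C _ _⟩

/-- For `A₀ = k[ε_ι]`: if `Φ` maps the scalars and every slot occurring in `g` into a subring `T` of `A₀[σ]`, then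
`Φ(C g) ∈ T` (derived here; with `T` = polynomials in `σ^{p+1}`: "`g₀(f_i + σ^{p+1}d_i)_{i≥2}` is a polynomial in
`σ^{p+1}`"). [cite: Matsumura1987, §27 (higher derivations), p. 207] -/
theorem apply_C_mem_of_vars {k : Type*} [CommRing k] {ι : Type*}
    {Φ : (MvPolynomial ι k)[X] →+* (MvPolynomial ι k)[X]} (T : Subring (MvPolynomial ι k)[X])
    (hC : ∀ c : k, Φ (C (MvPolynomial.C c)) ∈ T) {g : MvPolynomial ι k}
    (h : ∀ x ∈ g.vars, Φ (C (MvPolynomial.X x)) ∈ T) : Φ (C g) ∈ T := by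
  classical
  rw [g.as_sum, map_sum, map_sum]
  refine Subring.sum_mem _ fun d hd => ?_
  rw [MvPolynomial.monomial_eq, map_mul, map_mul, map_finsuppProd, map_finsuppProd]
  refine Subring.mul_mem _ (hC _) (Subring.prod_mem _ fun i hi => ?_)
  show Φ (C (MvPolynomial.X i ^ d i)) ∈ T
  rw [map_pow, map_pow]
  exact Subring.pow_mem _ (h i ((MvPolynomial.mem_vars_iff_mem_support i).mpr ⟨d, hd, hi⟩)) _

variable (p : ℕ) [Fact p.Prime] [CharP A₀ p]

/-- **THEOREM-F §4b leaf (a)** (derived here): if `Φ(C f₁) = C f₁ + σ·C ℓ + C d·σ^{p+1}`, `Φ(C a) = C a`, `Φ` fixes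
`a f₁^p + g₀`, and `Φ(C g₀)` is a polynomial in `σ^{p+1}`, then `a·ℓ^p = 0` — the `σ^p`-coefficient of (‡) reads
`D_p g₀ = −aℓ^p` and `p + 1 ∤ p`. [cite: Lang2002, Ch. V §6 (pp. 247–251)] -/
theorem mul_pow_eq_zero_of_isIsotropyOf_face_of_mem_range_expand (Φ : A₀[X] →+* A₀[X]) {f₁ ℓ d a g₀ : A₀}
    (hf : Φ (C f₁) = C f₁ + X * C ℓ + C d * X ^ (p + 1)) (ha : Φ (C a) = C a)
    (hfix : IsIsotropyOf (a * f₁ ^ p + g₀) Φ) (hg₀ : Φ (C g₀) ∈ (expand A₀ (p + 1)).range) :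
    a * ℓ ^ p = 0 := by
  have hp : 0 < p := (Fact.out : p.Prime).pos
  have hne : p ≠ p * (p + 1) := by
    have : p * 2 ≤ p * (p + 1) := Nat.mul_le_mul_left p (by have := (Fact.out : p.Prime).two_le; omega)
    omega
  have h := taylorCoeff_eq_of_isIsotropyOf_face p Φ hf ha hfix hp
  rw [taylorCoeff_eq_zero_of_mem_range_expand p.succ_pos hg₀ (Nat.not_dvd_of_pos_of_lt hp p.lt_succ_self),
    if_pos rfl, if_neg hne, add_zero] at h
  have h' : a * ℓ ^ p = -0 := by rw [h, neg_neg]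
  rwa [neg_zero] at h'

/-- Leaf (a) in a domain with `a ≠ 0`: `ℓ = 0` — "the `σ^p`-coefficient `aℓ(W)^p ≠ 0` contradicts `X(g) = g`"
(derived here). [cite: Lang2002, Ch. V §6 (pp. 247–251)] -/
theorem eq_zero_of_isIsotropyOf_face_of_mem_range_expand [IsDomain A₀] (Φ : A₀[X] →+* A₀[X]) {f₁ ℓ d a g₀ : A₀}
    (hf : Φ (C f₁) = C f₁ + X * C ℓ + C d * X ^ (p + 1)) (ha : Φ (C a) = C a) (ha0 : a ≠ 0)
    (hfix : IsIsotropyOf (a * f₁ ^ p + g₀) Φ) (hg₀ : Φ (C g₀) ∈ (expand A₀ (p + 1)).range) : ℓ = 0 := by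
  have h := mul_pow_eq_zero_of_isIsotropyOf_face_of_mem_range_expand p Φ hf ha hfix hg₀
  rcases mul_eq_zero.mp h with h0 | h0
  · exact absurd h0 ha0
  · exact (pow_eq_zero_iff (Fact.out : p.Prime).ne_zero).mp h0

/-- Leaf (a), slot form for `A₀ = k[ε]` (derived here): `Φ` fixing the scalars, `Φ(C ε_x) ∈ k[ε][σ^{p+1}]` for every
slot `x` of `g₀` (fixed slots: `C_mem_range_expand`; slots `f_i ↦ f_i + σ^{p+1}d_i`: `C_add_C_mul_X_pow_mem_range_expand`),
`Φ(C f₁) = C f₁ + σ C ℓ + C d σ^{p+1}`, `a ≠ 0` a fixed constant, `Φ` fixing `a f₁^p + g₀` ⇒ `ℓ = 0`.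
[cite: Lang2002, Ch. V §6 (pp. 247–251)] -/
theorem eq_zero_of_isIsotropyOf_face_of_vars {k : Type*} [Field k] [CharP k p] {ι : Type*}
    (Φ : (MvPolynomial ι k)[X] →+* (MvPolynomial ι k)[X]) (hR : FixesScalars k Φ)
    {f₁ ℓ d a g₀ : MvPolynomial ι k}
    (hf : Φ (C f₁) = C f₁ + X * C ℓ + C d * X ^ (p + 1)) (ha : Φ (C a) = C a) (ha0 : a ≠ 0)
    (hfix : IsIsotropyOf (a * f₁ ^ p + g₀) Φ)
    (hN : ∀ x ∈ g₀.vars, Φ (C (MvPolynomial.X x)) ∈ (expand (MvPolynomial ι k) (p + 1)).range) : ℓ = 0 := by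
  refine eq_zero_of_isIsotropyOf_face_of_mem_range_expand p Φ hf ha ha0 hfix ?_
  refine apply_C_mem_of_vars (expand (MvPolynomial ι k) (p + 1)).range.toSubring (fun c => ?_) hN
  have hc := hR c
  rw [MvPolynomial.algebraMap_eq] at hc
  rw [Subalgebra.mem_toSubring, hc]
  exact C_mem_range_expand _ _

end ExpandRange

end Literature.AlgebraicGeometry.Resolution.WeightedBlowup
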